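import Summits.CriticalPhenomena.PercolationContinuityZ3.Theorems.PercNearOneGluingNoHeavyPcintMemorySixDeficit
import Summits.CriticalPhenomena.PercolationContinuityZ3.Theorems.PercNearOneGluingNoHeavyPcintMemoryFourBrackets
import HarnessLib

/-!
# CriticalPhenomena/PercolationContinuityZ3 — Theorems/PercNearOneGluingNoHeavyPcintMemorySixStrict.lean: STRICT MONOTONICITY AT THE SECOND RUNG — `μ_6(d)⁷ ≤ μ_4(d)⁷ − 1`, so `μ_6(d) < μ_4(d)`, `Δ_6(d) > 0` and `R_6(d) > 0` for every `d ≥ 2`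

Lane prim-pcint, STRUCTURE rule.  The typed law C4 (…PcintLoopExclusionLaw) flags as "the first genuinely open clause"
the STRICT monotonicity `μ_τ < μ_{τ−2}` of the memory hierarchy (`Δ_τ > 0`, the lower half of the window (a)), proved in
the tree only at the first rung (`μ_4 < μ_2 = 2d − 1`, by counting).  Here it is proved at the second rung, `τ = 6`, for
every `d ≥ 2`, by a Perron–Frobenius DEFICIT argument made fully explicit:

* the end-class counts `(A, B, C)` of ANY prefix-closed family of memory-4 words obey the Fisher–Sykes upper recursion
  (…PcintMemorySixDeficit); weighting the classes by the LEFT PERRON VECTOR `ℓ = (kμ, μ(μ−1), (k−1)μ+1)` of the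
  recursion matrix (`k = 2d−2`, `μ = μ_4(d)`; `ℓM = μℓ` is the Fisher–Sykes cubic `μ³ = kμ² + kμ + 1`,
  `MemoryTail.memGrowth_four_cubic_eq`) gives the potential inequality `Φ(one-step extensions of S) ≤ μ_4 · Φ(S)`
  (`potential_ext_le`);
* the memory-6 words of length `n + 10` and the hexagon continuations `w · r r b b r⁻ b⁻ b⁻` of the memory-6 words `w` of
  length `n + 3` (`hexagon_continuation`: memory-4, class `A`, injective, NOT memory-6) are DISJOINT families of 7-step
  memory-4 extensions, so `Φ(W⁶_{n+10}) ≤ μ_4⁷ Φ(W⁶_{n+3}) − ℓ_A · #W⁶_{n+3} ≤ (μ_4⁷ − 1) · Φ(W⁶_{n+3})`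
  (`potential_six_step_seven`; `ℓ_A` is the largest weight);
* hence `c_{7j+3,6} ≤ ℓ_A (2d)³ (μ_4⁷ − 1)^j` and, with `μ_6^{7j+3} ≤ c_{7j+3,6}`, **`memGrowth_six_pow_seven_le`:
  `μ_6(d)⁷ ≤ μ_4(d)⁷ − 1`**; so **`memGrowth_six_lt_memGrowth_four`: `μ_6(d) < μ_4(d)`**, **`memLoopCost_six_pos`:
  `Δ_6(d) > 0`**, **`loopCompat_six_pos`: `R_6(d) > 0`** and `loopCompatWindow_rung_six_left` (the lower half of the
  typed window at `m = 3`), every `d ≥ 2`.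

The bound is crude (`Δ_6 ≥ −ln(1 − μ_4⁻⁷)/7`, e.g. `≥ 3·10⁻⁶` on `ℤ³` against the measured `Δ_6(3) = 0.0196`) but uniform in
`d`; the method (explicit Perron vector of the SMALLER automaton + one forbidden continuation) is the template for every
rung where the smaller automaton's Perron vector is known.

HONEST FRAMING: elementary; nothing here is used by a certified `p_c` cell.  Written by prim-pcint-2 gen 17
(prover-prim-pcint-2-g17-0), 2026-08-25.
-/

noncomputable section

open Filter Topology
open Literature.Probability.LatticeModels Literature.Probability.Percolation
open Literature.Probability.RandomPlanarGeometry.SAW.Zd (endA endB endC EndTurn EndU)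
open Summit.CriticalPhenomena.PercolationContinuityZ3.Theorems.Pcint

namespace Summit.CriticalPhenomena.PercolationContinuityZ3.Theorems.Pcint.MemoryTail

variable {d : ℕ}

/-- The left Perron weights of the Fisher–Sykes recursion, `ℓ_A = kμ`, `ℓ_B = μ(μ−1)`, `ℓ_C = (k−1)μ + 1`
(`k = 2d − 2`, `μ = μ_4(d)`), and the weighted class count `Φ` of a set of words of length `m + 3`. -/
local notation "ℓA" => ((2 * (d : ℝ) - 2) * memGrowth d 4)
local notation "ℓB" => (memGrowth d 4 * (memGrowth d 4 - 1))
local notation "ℓC" => ((2 * (d : ℝ) - 3) * memGrowth d 4 + 1)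
set_option quotPrecheck false in
local notation "Φ[" m "](" S ")" =>
  (((2 * (d : ℝ) - 2) * memGrowth d 4) * ((Finset.card (Finset.filter (fun v => v ∈ endA d m) S) : ℕ) : ℝ)
    + (memGrowth d 4 * (memGrowth d 4 - 1)) * ((Finset.card (Finset.filter (fun v => v ∈ endB d m) S) : ℕ) : ℝ)
    + ((2 * (d : ℝ) - 3) * memGrowth d 4 + 1) * ((Finset.card (Finset.filter (fun v => v ∈ endC d m) S) : ℕ) : ℝ))

/-! ### The weights -/

/-- `μ_4(d) ≥ 2` for `d ≥ 2`. [folklore] -/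
theorem two_le_memGrowth_four (hd : 2 ≤ d) : (2 : ℝ) ≤ memGrowth d 4 := by
  have hd' : (2 : ℝ) ≤ d := by exact_mod_cast hd
  linarith [two_mul_sub_two_le_memGrowth_four hd]

/-- The weights are `≥ 1` and `ℓ_A` is the largest. [folklore] -/
theorem fsWeights_bounds (hd : 2 ≤ d) :
    1 ≤ ℓA ∧ 1 ≤ ℓB ∧ 1 ≤ ℓC ∧ ℓB ≤ ℓA ∧ ℓC ≤ ℓA := by
  have hd' : (2 : ℝ) ≤ d := by exact_mod_cast hd
  have hμ2 := two_le_memGrowth_four hd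
  have hμlt := memGrowth_four_lt hd
  refine ⟨by nlinarith, by nlinarith, by nlinarith, by nlinarith, by nlinarith⟩

/-- **`ℓ` is a left eigenvector of the Fisher–Sykes recursion with eigenvalue `μ_4(d)`**: the `A`- and `C`-identities are
algebra, the `B`-identity is the cubic `μ³ = kμ² + kμ + 1`. [cite: MadrasSlade1993, §1.2, eq. (1.2.14)] -/
theorem fsWeights_eigen (hd : 2 ≤ d) :
    ℓA + (2 * (d : ℝ) - 2) * ℓB = memGrowth d 4 * ℓA ∧
    ℓA + (2 * (d : ℝ) - 3) * ℓB + ℓC = memGrowth d 4 * ℓB ∧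
    ℓA + (2 * (d : ℝ) - 3) * ℓB = memGrowth d 4 * ℓC := by
  have hcub := memGrowth_four_cubic_eq hd
  refine ⟨by ring, ?_, by ring⟩
  nlinarith [hcub]

/-! ### The potential inequality for one-step extensions -/

/-- The end-class sub-families of the one-step extensions of `S` are the extension families of the Literature classes.
[folklore] -/
theorem filter_ext_eq {m : ℕ} (S : Finset (Fin (m + 3) → Fin d × Bool)) (E : Finset (Fin (m + 4) → Fin d × Bool))
    (hE : E ⊆ memFourWords d (m + 4)) :
    ((memFourWords d (m + 4)).filter fun v => wordInit v ∈ S).filter (fun v => v ∈ E)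
      = E.filter fun v => wordInit v ∈ S := by
  ext v
  simp only [Finset.mem_filter]
  constructor
  · rintro ⟨⟨_, h2⟩, h3⟩; exact ⟨h3, h2⟩
  · rintro ⟨h1, h2⟩; exact ⟨⟨hE h1, h2⟩, h1⟩

/-- **`Φ(one-step memory-4 extensions of S) ≤ μ_4(d) · Φ(S)`** for every set `S` of memory-4 words of length `m + 3`.
[folklore] -/
theorem potential_ext_le (hd : 2 ≤ d) {m : ℕ} (S : Finset (Fin (m + 3) → Fin d × Bool))
    (hS : S ⊆ memFourWords d (m + 3)) :
    Φ[m + 1](((memFourWords d (m + 4)).filter fun v => wordInit v ∈ S)) ≤ memGrowth d 4 * Φ[m](S) := by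
  classical
  obtain ⟨hA1, hB1, hC1, hBA, hCA⟩ := fsWeights_bounds hd
  obtain ⟨eA, eB, eC⟩ := fsWeights_eigen hd
  have hd2 : 3 ≤ 2 * d := by omega
  -- the three class families of the extensions
  rw [filter_ext_eq S (endA d (m + 1)) (Finset.filter_subset _ _),
    filter_ext_eq S (endB d (m + 1)) (Finset.filter_subset _ _),
    filter_ext_eq S (endC d (m + 1)) (Finset.filter_subset _ _)]
  -- the restricted recursion, cast to ℝ
  have ha := card_endA_succ_filter_le (d := d) S
  have hb := card_endB_succ_filter_le (d := d) S hS
  have hc := card_endC_succ_filter_le (d := d) S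
  have hpart := card_filter_endABC S hS
  set a := ((S.filter fun u => u ∈ endA d m).card : ℝ) with ha'
  set b := ((S.filter fun u => u ∈ endB d m).card : ℝ) with hb'
  set c := ((S.filter fun u => u ∈ endC d m).card : ℝ) with hc'
  have ha_r : (((endA d (m + 1)).filter fun w => wordInit w ∈ S).card : ℝ) ≤ a + b + c := by
    have : (((endA d (m + 1)).filter fun w => wordInit w ∈ S).card : ℝ) ≤ (S.card : ℝ) := by exact_mod_cast ha
    rw [← hpart] at this; push_cast at this; linarith
  have hb_r : (((endB d (m + 1)).filter fun w => wordInit w ∈ S).card : ℝ) ≤ (2 * d - 2) * a + (2 * d - 3) * (b + c) := by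
    have := (Nat.cast_le (α := ℝ)).2 hb
    rw [Nat.cast_add, Nat.cast_mul, Nat.cast_mul, Nat.cast_sub (by omega), Nat.cast_sub hd2, Nat.cast_add] at this
    push_cast at this
    linarith
  have hc_r : (((endC d (m + 1)).filter fun w => wordInit w ∈ S).card : ℝ) ≤ b := by
    rw [hb']; exact_mod_cast hc
  have hd' : (2 : ℝ) ≤ d := by exact_mod_cast hd
  have hk1 : (0 : ℝ) ≤ 2 * d - 3 := by linarith
  calc ℓA * (((endA d (m + 1)).filter fun w => wordInit w ∈ S).card : ℝ)
        + ℓB * (((endB d (m + 1)).filter fun w => wordInit w ∈ S).card : ℝ)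
        + ℓC * (((endC d (m + 1)).filter fun w => wordInit w ∈ S).card : ℝ)
      ≤ ℓA * (a + b + c) + ℓB * ((2 * d - 2) * a + (2 * d - 3) * (b + c)) + ℓC * b := by
        have e1 := mul_le_mul_of_nonneg_left ha_r (by linarith : (0 : ℝ) ≤ ℓA)
        have e2 := mul_le_mul_of_nonneg_left hb_r (by linarith : (0 : ℝ) ≤ ℓB)
        have e3 := mul_le_mul_of_nonneg_left hc_r (by linarith : (0 : ℝ) ≤ ℓC)
        linarith
    _ = (ℓA + (2 * (d : ℝ) - 2) * ℓB) * a + (ℓA + (2 * (d : ℝ) - 3) * ℓB + ℓC) * b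
          + (ℓA + (2 * (d : ℝ) - 3) * ℓB) * c := by ring
    _ = memGrowth d 4 * (ℓA * a + ℓB * b + ℓC * c) := by rw [eA, eB, eC]; ring

/-! ### Memory-6 words and the seven-step deficit -/

/-- Memory 6 implies memory 4 (as the Fisher–Sykes predicate). [folklore] -/
theorem isMemFour_of_isMem_six {m : ℕ} {v : Fin m → Fin d × Bool} (h : IsMem 6 v) : IsMemFour v :=
  isMemFour_of_isMem_four fun i j hj hij hτ => h i j hj hij (by omega)

/-- The memory-6 words are memory-4 words. [folklore] -/
theorem memWords_six_subset (d m : ℕ) : memWords d 6 m ⊆ memFourWords d m := fun _ hv =>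
  mem_memFourWords.2 (isMemFour_of_isMem_six (mem_memWords.1 hv))

/-- `#S ≤ Φ(S)` for a set of memory-4 words (all weights are `≥ 1`). [folklore] -/
theorem card_le_potential (hd : 2 ≤ d) {m : ℕ} (S : Finset (Fin (m + 3) → Fin d × Bool))
    (hS : S ⊆ memFourWords d (m + 3)) : (S.card : ℝ) ≤ Φ[m](S) := by
  obtain ⟨hA1, hB1, hC1, -, -⟩ := fsWeights_bounds hd
  have hpart := card_filter_endABC S hS
  have h : (S.card : ℝ) = ((S.filter fun u => u ∈ endA d m).card : ℝ) + ((S.filter fun u => u ∈ endB d m).card : ℝ)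
      + ((S.filter fun u => u ∈ endC d m).card : ℝ) := by exact_mod_cast hpart.symm
  rw [h]
  nlinarith [Nat.cast_nonneg (α := ℝ) (S.filter fun u => u ∈ endA d m).card,
    Nat.cast_nonneg (α := ℝ) (S.filter fun u => u ∈ endB d m).card,
    Nat.cast_nonneg (α := ℝ) (S.filter fun u => u ∈ endC d m).card]

/-- `Φ(S) ≤ ℓ_A · #S` (`ℓ_A` is the largest weight). [folklore] -/
theorem potential_le_card (hd : 2 ≤ d) {m : ℕ} (S : Finset (Fin (m + 3) → Fin d × Bool))
    (hS : S ⊆ memFourWords d (m + 3)) : Φ[m](S) ≤ ℓA * S.card := by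
  obtain ⟨hA1, hB1, hC1, hBA, hCA⟩ := fsWeights_bounds hd
  have hpart := card_filter_endABC S hS
  have h : (S.card : ℝ) = ((S.filter fun u => u ∈ endA d m).card : ℝ) + ((S.filter fun u => u ∈ endB d m).card : ℝ)
      + ((S.filter fun u => u ∈ endC d m).card : ℝ) := by exact_mod_cast hpart.symm
  rw [h]
  nlinarith [Nat.cast_nonneg (α := ℝ) (S.filter fun u => u ∈ endA d m).card,
    Nat.cast_nonneg (α := ℝ) (S.filter fun u => u ∈ endB d m).card,
    Nat.cast_nonneg (α := ℝ) (S.filter fun u => u ∈ endC d m).card]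

/-- `Φ` is monotone under inclusion. [folklore] -/
theorem potential_mono (hd : 2 ≤ d) {m : ℕ} {S T : Finset (Fin (m + 3) → Fin d × Bool)} (h : S ⊆ T) :
    Φ[m](S) ≤ Φ[m](T) := by
  obtain ⟨hA1, hB1, hC1, -, -⟩ := fsWeights_bounds hd
  have h1 : ((S.filter fun u => u ∈ endA d m).card : ℝ) ≤ ((T.filter fun u => u ∈ endA d m).card : ℝ) := by
    exact_mod_cast Finset.card_le_card (Finset.filter_subset_filter _ h)
  have h2 : ((S.filter fun u => u ∈ endB d m).card : ℝ) ≤ ((T.filter fun u => u ∈ endB d m).card : ℝ) := by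
    exact_mod_cast Finset.card_le_card (Finset.filter_subset_filter _ h)
  have h3 : ((S.filter fun u => u ∈ endC d m).card : ℝ) ≤ ((T.filter fun u => u ∈ endC d m).card : ℝ) := by
    exact_mod_cast Finset.card_le_card (Finset.filter_subset_filter _ h)
  nlinarith

/-- **The seven-step deficit inequality**: `Φ(W⁶_{n+10}) ≤ (μ_4⁷ − 1) · Φ(W⁶_{n+3})`, where `W⁶_m` are the memory-6 words
of length `m`. [folklore] -/
theorem potential_six_step_seven (hd : 2 ≤ d) (n : ℕ) :
    Φ[n + 7](memWords d 6 (n + 10)) ≤ (memGrowth d 4 ^ 7 - 1) * Φ[n](memWords d 6 (n + 3)) := by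
  classical
  set μ := memGrowth d 4 with hμ
  have hμ1 : (1 : ℝ) < μ := by linarith [two_le_memGrowth_four hd]
  obtain ⟨hA1, hB1, hC1, hBA, hCA⟩ := fsWeights_bounds hd
  -- the chain of extension families
  set S0 : Finset (Fin (n + 3) → Fin d × Bool) := memWords d 6 (n + 3) with hS0
  set S1 := (memFourWords d (n + 4)).filter fun v => wordInit v ∈ S0 with hS1
  set S2 := (memFourWords d (n + 5)).filter fun v => wordInit v ∈ S1 with hS2
  set S3 := (memFourWords d (n + 6)).filter fun v => wordInit v ∈ S2 with hS3
  set S4 := (memFourWords d (n + 7)).filter fun v => wordInit v ∈ S3 with hS4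
  set S5 := (memFourWords d (n + 8)).filter fun v => wordInit v ∈ S4 with hS5
  set S6 := (memFourWords d (n + 9)).filter fun v => wordInit v ∈ S5 with hS6
  set S7 := (memFourWords d (n + 10)).filter fun v => wordInit v ∈ S6 with hS7
  have hS0m : S0 ⊆ memFourWords d (n + 3) := memWords_six_subset d _
  have h1 : Φ[n + 1](S1) ≤ μ * Φ[n](S0) := potential_ext_le hd S0 hS0m
  have h2 : Φ[n + 2](S2) ≤ μ * Φ[n + 1](S1) := potential_ext_le hd S1 (Finset.filter_subset _ _)
  have h3 : Φ[n + 3](S3) ≤ μ * Φ[n + 2](S2) := potential_ext_le hd S2 (Finset.filter_subset _ _)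
  have h4 : Φ[n + 4](S4) ≤ μ * Φ[n + 3](S3) := potential_ext_le hd S3 (Finset.filter_subset _ _)
  have h5 : Φ[n + 5](S5) ≤ μ * Φ[n + 4](S4) := potential_ext_le hd S4 (Finset.filter_subset _ _)
  have h6 : Φ[n + 6](S6) ≤ μ * Φ[n + 5](S5) := potential_ext_le hd S5 (Finset.filter_subset _ _)
  have h7 : Φ[n + 7](S7) ≤ μ * Φ[n + 6](S6) := potential_ext_le hd S6 (Finset.filter_subset _ _)
  have hμ0 : (0 : ℝ) ≤ μ := by linarith
  have h17 : Φ[n + 7](S7) ≤ μ ^ 7 * Φ[n](S0) := by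
    calc Φ[n + 7](S7) ≤ μ * Φ[n + 6](S6) := h7
      _ ≤ μ * (μ * Φ[n + 5](S5)) := mul_le_mul_of_nonneg_left h6 hμ0
      _ ≤ μ * (μ * (μ * Φ[n + 4](S4))) := by gcongr
      _ ≤ μ * (μ * (μ * (μ * Φ[n + 3](S3)))) := by gcongr
      _ ≤ μ * (μ * (μ * (μ * (μ * Φ[n + 2](S2))))) := by gcongr
      _ ≤ μ * (μ * (μ * (μ * (μ * (μ * Φ[n + 1](S1)))))) := by gcongr
      _ ≤ μ * (μ * (μ * (μ * (μ * (μ * (μ * Φ[n](S0))))))) := by gcongr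
      _ = μ ^ 7 * Φ[n](S0) := by ring
  -- membership in the seventh extension family, letter by letter
  have hmem7 : ∀ v : Fin (n + 10) → Fin d × Bool, IsMemFour v →
      wordInit (wordInit (wordInit (wordInit (wordInit (wordInit (wordInit v)))))) ∈ S0 → v ∈ S7 := by
    intro v hv h0
    have i1 := isMemFour_wordInit' hv
    have i2 := isMemFour_wordInit' i1
    have i3 := isMemFour_wordInit' i2
    have i4 := isMemFour_wordInit' i3
    have i5 := isMemFour_wordInit' i4
    have i6 := isMemFour_wordInit' i5
    simp only [hS7, hS6, hS5, hS4, hS3, hS2, hS1, Finset.mem_filter, mem_memFourWords]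
    exact ⟨hv, i1, i2, i3, i4, i5, i6, h0⟩
  -- the memory-6 words of length n+10 lie in S7
  have hW7 : memWords d 6 (n + 10) ⊆ S7 := by
    intro v hv
    have h6v : IsMem 6 v := mem_memWords.1 hv
    refine hmem7 v (isMemFour_of_isMem_six h6v) ?_
    rw [hS0, mem_memWords]
    exact h6v.wordInit.wordInit.wordInit.wordInit.wordInit.wordInit.wordInit
  -- the hexagon continuations lie in S7 ∩ A, are as many as S0, and are not memory-6 words
  obtain ⟨c, hcinj, hcpre, hcmem, hcA, hc6⟩ := hexagon_continuation hd n
  have hcS7 : ∀ w ∈ S0, c w ∈ S7 := by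
    intro w hw
    have hw4 : IsMemFour w := isMemFour_of_isMem_six (by rw [hS0, mem_memWords] at hw; exact hw)
    refine hmem7 (c w) (hcmem w hw4) ?_
    have : wordInit (wordInit (wordInit (wordInit (wordInit (wordInit (wordInit (c w))))))) = w := by
      funext i; exact hcpre w i
    rw [this]; exact hw
  -- class A count: the two families are disjoint
  have hAcount : (((memWords d 6 (n + 10)).filter fun v => v ∈ endA d (n + 7)).card : ℝ) + (S0.card : ℝ)
      ≤ ((S7.filter fun v => v ∈ endA d (n + 7)).card : ℝ) := by
    have himg : (S0.image c).card = S0.card := Finset.card_image_of_injective _ hcinj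
    have hdisj : Disjoint ((memWords d 6 (n + 10)).filter fun v => v ∈ endA d (n + 7)) (S0.image c) := by
      rw [Finset.disjoint_left]
      intro v hv hv'
      rw [Finset.mem_image] at hv'
      obtain ⟨w, -, rfl⟩ := hv'
      rw [Finset.mem_filter, mem_memWords] at hv
      exact hc6 w hv.1
    have hsub : ((memWords d 6 (n + 10)).filter fun v => v ∈ endA d (n + 7)) ∪ S0.image c
        ⊆ S7.filter fun v => v ∈ endA d (n + 7) := by
      intro v hv
      rw [Finset.mem_union] at hv
      rw [Finset.mem_filter]
      rcases hv with hv | hv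
      · rw [Finset.mem_filter] at hv; exact ⟨hW7 hv.1, hv.2⟩
      · rw [Finset.mem_image] at hv
        obtain ⟨w, hw, rfl⟩ := hv
        have hw4 : IsMemFour w := isMemFour_of_isMem_six (by rw [hS0, mem_memWords] at hw; exact hw)
        refine ⟨hcS7 w hw, ?_⟩
        rw [endA, Finset.mem_filter, mem_memFourWords]
        exact ⟨hcmem w hw4, hcA w⟩
    have := Finset.card_le_card hsub
    rw [Finset.card_union_of_disjoint hdisj, himg] at this
    exact_mod_cast this
  have hBcount : (((memWords d 6 (n + 10)).filter fun v => v ∈ endB d (n + 7)).card : ℝ)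
      ≤ ((S7.filter fun v => v ∈ endB d (n + 7)).card : ℝ) := by
    exact_mod_cast Finset.card_le_card (Finset.filter_subset_filter _ hW7)
  have hCcount : (((memWords d 6 (n + 10)).filter fun v => v ∈ endC d (n + 7)).card : ℝ)
      ≤ ((S7.filter fun v => v ∈ endC d (n + 7)).card : ℝ) := by
    exact_mod_cast Finset.card_le_card (Finset.filter_subset_filter _ hW7)
  -- Φ(W_{n+10}) + ℓA #S0 ≤ Φ(S7) ≤ μ^7 Φ(S0), and Φ(S0) ≤ ℓA #S0
  have hΦS0 : Φ[n](S0) ≤ ℓA * S0.card := potential_le_card hd S0 hS0m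
  have eA := mul_le_mul_of_nonneg_left hAcount (by linarith : (0 : ℝ) ≤ ℓA)
  have eB := mul_le_mul_of_nonneg_left hBcount (by linarith : (0 : ℝ) ≤ ℓB)
  have eC := mul_le_mul_of_nonneg_left hCcount (by linarith : (0 : ℝ) ≤ ℓC)
  rw [mul_add] at eA
  linarith [eA, eB, eC, h17, hΦS0]

/-- **`c_{7j+3,6} ≤ ℓ_A · (2d)³ · (μ_4⁷ − 1)^j`**. [folklore] -/
theorem memCount_six_le (hd : 2 ≤ d) (j : ℕ) :
    (memCount d 6 (7 * j + 3) : ℝ) ≤ ℓA * (2 * d) ^ 3 * (memGrowth d 4 ^ 7 - 1) ^ j := by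
  have hμ2 := two_le_memGrowth_four hd
  have hq : (0 : ℝ) ≤ memGrowth d 4 ^ 7 - 1 := by
    have : (1 : ℝ) ≤ memGrowth d 4 ^ 7 := one_le_pow₀ (by linarith)
    linarith
  -- Φ(W_{7j+3}) ≤ (μ^7 − 1)^j Φ(W_3), via the sequence f n := Φ(W_{n+3})
  set f : ℕ → ℝ := fun n => Φ[n](memWords d 6 (n + 3)) with hf
  have hstep : ∀ n : ℕ, f (n + 7) ≤ (memGrowth d 4 ^ 7 - 1) * f n := fun n => potential_six_step_seven hd n
  have hiter : ∀ j : ℕ, f (7 * j) ≤ (memGrowth d 4 ^ 7 - 1) ^ j * f 0 := by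
    intro j
    induction j with
    | zero => simp
    | succ j ih =>
      rw [show 7 * (j + 1) = 7 * j + 7 by ring]
      calc f (7 * j + 7) ≤ (memGrowth d 4 ^ 7 - 1) * f (7 * j) := hstep (7 * j)
        _ ≤ (memGrowth d 4 ^ 7 - 1) * ((memGrowth d 4 ^ 7 - 1) ^ j * f 0) := mul_le_mul_of_nonneg_left ih hq
        _ = (memGrowth d 4 ^ 7 - 1) ^ (j + 1) * f 0 := by ring
  have h0 : f 0 ≤ ℓA * (2 * d) ^ 3 := by
    show Φ[0](memWords d 6 (0 + 3)) ≤ _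
    refine (potential_le_card hd (memWords d 6 3) (memWords_six_subset d 3)).trans ?_
    have hc : ((memWords d 6 3).card : ℝ) ≤ (2 * d) ^ 3 := by
      have := memCount_le_pow d 6 3
      unfold memCount at this
      exact_mod_cast this
    have hℓA0 : (0 : ℝ) ≤ ℓA := by
      have hd' : (2 : ℝ) ≤ d := by exact_mod_cast hd
      nlinarith
    exact mul_le_mul_of_nonneg_left hc hℓA0
  calc (memCount d 6 (7 * j + 3) : ℝ) = ((memWords d 6 (7 * j + 3)).card : ℝ) := by rfl
    _ ≤ f (7 * j) := card_le_potential hd _ (memWords_six_subset d _)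
    _ ≤ (memGrowth d 4 ^ 7 - 1) ^ j * f 0 := hiter j
    _ ≤ (memGrowth d 4 ^ 7 - 1) ^ j * (ℓA * (2 * d) ^ 3) := mul_le_mul_of_nonneg_left h0 (pow_nonneg hq j)
    _ = ℓA * (2 * d) ^ 3 * (memGrowth d 4 ^ 7 - 1) ^ j := by ring

/-! ### Strict monotonicity at the second rung -/

/-- **`μ_6(d)⁷ ≤ μ_4(d)⁷ − 1`** for every `d ≥ 2` (from `μ_6^{7j+3} ≤ c_{7j+3,6} ≤ K (μ_4⁷ − 1)^j` for all `j`). [folklore] -/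
theorem memGrowth_six_pow_seven_le (hd : 2 ≤ d) : memGrowth d 6 ^ 7 ≤ memGrowth d 4 ^ 7 - 1 := by
  haveI : NeZero d := ⟨by omega⟩
  have hd' : (2 : ℝ) ≤ d := by exact_mod_cast hd
  set q : ℝ := memGrowth d 4 ^ 7 - 1 with hq
  have hμ2 := two_le_memGrowth_four hd
  have hq1 : (1 : ℝ) < q := by
    have : (2 : ℝ) ^ 7 ≤ memGrowth d 4 ^ 7 := pow_le_pow_left₀ (by norm_num) hμ2 7
    rw [hq]; nlinarith
  have hq0 : 0 < q := by linarith
  have hμ6 : 0 < memGrowth d 6 := memGrowth_pos 6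
  set K : ℝ := ℓA * (2 * d) ^ 3 with hK
  have hK0 : 0 < K := by rw [hK]; exact mul_pos (by nlinarith) (by positivity)
  -- for every j: μ_6^{7j+3} ≤ K q^j
  have hj : ∀ j : ℕ, memGrowth d 6 ^ (7 * j + 3) ≤ K * q ^ j := fun j =>
    ((pow_memGrowth_le_memCount d 6 (7 * j + 2)).trans (by exact_mod_cast le_rfl)).trans (memCount_six_le hd j)
  by_contra hcon
  have hlt : q < memGrowth d 6 ^ 7 := lt_of_not_ge hcon
  -- then (μ_6^7/q)^j is unbounded, contradicting μ_6^3 (μ_6^7/q)^j ≤ K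
  have hr : 1 < memGrowth d 6 ^ 7 / q := (one_lt_div hq0).2 hlt
  obtain ⟨j, hjK⟩ := pow_unbounded_of_one_lt (K / memGrowth d 6 ^ 3) hr
  have h1 := hj j
  have h2 : memGrowth d 6 ^ (7 * j + 3) = memGrowth d 6 ^ 3 * (memGrowth d 6 ^ 7 / q) ^ j * q ^ j := by
    rw [div_pow, pow_add, pow_mul]
    field_simp
  rw [h2] at h1
  have h3 : memGrowth d 6 ^ 3 * (memGrowth d 6 ^ 7 / q) ^ j ≤ K :=
    le_of_mul_le_mul_right (by linarith [h1]) (pow_pos hq0 j)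
  have h4 : (memGrowth d 6 ^ 7 / q) ^ j ≤ K / memGrowth d 6 ^ 3 := by
    rw [le_div_iff₀ (pow_pos hμ6 3)]
    linarith [h3]
  linarith

/-- **Strict monotonicity at the second rung: `μ_6(d) < μ_4(d)`** for every `d ≥ 2`. [folklore] -/
theorem memGrowth_six_lt_memGrowth_four (hd : 2 ≤ d) : memGrowth d 6 < memGrowth d 4 := by
  have h := memGrowth_six_pow_seven_le hd
  have h7 : memGrowth d 6 ^ 7 < memGrowth d 4 ^ 7 := by linarith
  exact lt_of_pow_lt_pow_left₀ 7 (memGrowth_nonneg d 4) h7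

/-- **`Δ_6(d) > 0`** for every `d ≥ 2`: the rung cost of forbidding the hexagons is strictly positive. [folklore] -/
theorem memLoopCost_six_pos (hd : 2 ≤ d) : 0 < memLoopCost d 6 := by
  haveI : NeZero d := ⟨by omega⟩
  unfold memLoopCost
  rw [show (6 : ℕ) - 2 = 4 from rfl]
  exact Real.log_pos ((one_lt_div (memGrowth_pos 6)).2 (memGrowth_six_lt_memGrowth_four hd))

/-- **`R_6(d) > 0`** for every `d ≥ 2` — the lower half of the typed window `loopCompatWindow` at the second rung.
[folklore] -/
theorem loopCompat_six_pos (hd : 2 ≤ d) : 0 < loopCompat d 6 := by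
  haveI : NeZero d := ⟨by omega⟩
  have hf : 0 < memLoopDensity d 6 := by simpa using memLoopDensity_even_pos (d := d) hd (m := 3) (by norm_num)
  exact div_pos (memLoopCost_six_pos hd) hf

/-- The `m = 3` instance of the LOWER inequality of the typed conjecture `loopCompatWindow`: `0 < R_6(d)`, every `d ≥ 2`.
[folklore] -/
theorem loopCompatWindow_rung_six_left (d : ℕ) (hd : 2 ≤ d) : 0 < loopCompat d (2 * 3) :=
  loopCompat_six_pos hd

end Summit.CriticalPhenomena.PercolationContinuityZ3.Theorems.Pcint.MemoryTail
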